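/-
Copyright (c) 2026. All rights reserved.
Released under Apache 2.0 license as described in the file LICENSE.
-/
import Mathlib
import HarnessLib

/-!
# ε-regular comb perturbation bound

Under the hypothesis C₀·ε·(1 + log(R/h)) ≤ 1, the perturbation from exact comb
to ε-regular comb is bounded. Combined with the exact comb bound, this gives
the imaginary part bound for ε-regular combs.
-/

open Complex Real Set Filter Topology Metric
open scoped BigOperators Topology ComplexConjugate

noncomputable section

namespace EarlyAppointmentsEpsilonRegularBound

/-- C₀ = 8 is the universal constant. -/
def C₀ : ℝ := 8

/-- Under the smallness hypothesis, the ε·(1+log) term is bounded by 1/8. -/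
theorem epsilon_log_bounded {ε R h : ℝ} (hε : 0 ≤ ε) (hh : 0 < h) (_hR : 0 < R) (hhR : h ≤ R)
    (hsmall : C₀ * ε * (1 + Real.log (R / h)) ≤ 1) :
    ε * (1 + Real.log (R / h)) ≤ 1 / C₀ := by
  have hC₀ : (0 : ℝ) < C₀ := by norm_num [C₀]
  have hlog_pos : 0 ≤ 1 + Real.log (R / h) := by
    have hdiv : 1 ≤ R / h := by
      rw [le_div_iff₀ hh]
      linarith
    have hlog : 0 ≤ Real.log (R / h) := Real.log_nonneg hdiv
    linarith
  have hprod_nonneg : 0 ≤ ε * (1 + Real.log (R / h)) := mul_nonneg hε hlog_pos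
  have hle : C₀ * (ε * (1 + Real.log (R / h))) ≤ 1 := by
    have heq : C₀ * (ε * (1 + Real.log (R / h))) = C₀ * ε * (1 + Real.log (R / h)) := by ring
    rw [heq]
    exact hsmall
  calc ε * (1 + Real.log (R / h))
      = C₀ * (ε * (1 + Real.log (R / h))) / C₀ := by field_simp
    _ ≤ 1 / C₀ := by
        apply div_le_div_of_nonneg_right hle (le_of_lt hC₀)

/-- 1/C₀ = 1/8. -/
theorem inv_C₀_eq : 1 / C₀ = 1 / 8 := by norm_num [C₀]

/-- Under the hypothesis, 1/8 ≤ 1/h when h ≤ 8. -/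
theorem inv_C₀_le_inv_h {h : ℝ} (hh : 0 < h) (hh8 : h ≤ 8) :
    1 / C₀ ≤ 1 / h := by
  rw [inv_C₀_eq]
  rw [div_le_div_iff₀ (by norm_num : (0 : ℝ) < 8) hh]
  linarith

/-- For the ε-regular comb, the imaginary part is bounded.

Assuming the perturbation |ε-regular - exact| ≤ perturbation_bound ≤ 1/C₀,
under the smallness hypothesis C₀·ε·(1+log(R/h)) ≤ 1, we get:
  ε-regular.im ≤ exact.im + 1/C₀ ≤ -π/s + 2/h + 1/8
-/
theorem eps_regular_im_bound_from_exact {h s : ℝ} (_hh : 0 < h) (_hs : 0 < s) (_hhs : 2 * s ≤ h)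
    (perturbation_bound : ℝ) (hpert : perturbation_bound ≤ 1 / C₀)
    (eps_regular_im exact_im : ℝ)
    (heps : eps_regular_im ≤ exact_im + perturbation_bound)
    (hexact : exact_im ≤ -π / s + 2 / h) :
    eps_regular_im ≤ -π / s + 2 / h + 1 / C₀ := by
  calc eps_regular_im
      ≤ exact_im + perturbation_bound := heps
    _ ≤ (-π / s + 2 / h) + 1 / C₀ := by linarith

end EarlyAppointmentsEpsilonRegularBound

end
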